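import Literature.NumberTheory.ComplexMultiplication.CMOrderOverorderPicardClasses
import HarnessLib

/-!
# The strata `ICM_{S′}` do not depend on the base order: `ICM_{S′}(𝔯) = ICM_{S′}(S)` for `𝔯 ⊆ S ⊆ S′`, and
# `#ICM(𝔯) = #ICM(S) + Σ_{S′ ⊉ S} #ICM_{S′}(𝔯)`

Layer A3 of the Hodge/CM programme (docs/m5/MAPPING.md §1), the "arbitrary order" series.  An `𝔯`-ideal with
multiplicator ring `S′ ⊇ S ⊇ 𝔯` IS an `S`-ideal with multiplicator ring `S′` (same lattice; the multiplicator ring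
`(I:I) = {x : xI ⊆ I}` is intrinsic to the lattice), and isomorphism / weak equivalence are read on lattices too.  Hence
for orders `𝔯 = endOrder (M_μ) ⊆ S = endOrder (M_ν)`:

* §1 `coe_div_eq_coe_div_of_coe_eq` (`(M:N)` is intrinsic), **`nonempty_quot_stratum_equiv_quot_stratum_of_le`** /
  `natCard_quot_stratum_eq_of_le` — `ICM_{S′}(𝔯) ≃ ICM_{S′}(S)`; `natCard_quot_stratum_weak_eq_of_le` — `W̄k_{S′}`
  likewise [Marseglia2019, §2 («`I` is also an `S`-ideal … iff `IS = I`»), §3 Lemma 3.6, §4 Def. 4.2];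
* §2 **`natCard_quot_fractionalIdeal_eq_sum_of_le`** (`#ICM(S) = Σ_{S′ ⊇ S} #ICM_{S′}(𝔯)`) and
  **`natCard_quot_fractionalIdeal_eq_natCard_add_sum`**: `#ICM(𝔯) = #ICM(S) + Σ_{S′ ⊇ 𝔯, S′ ⊉ S} #ICM_{S′}(𝔯)` — the
  exact form of the monotonicity `#ICM(S) ≤ #ICM(𝔯)` of `CMTorusIsomorphismClassesOrderMonotone`
  [Marseglia2019, §3 («`ICM(R) = ⊔ ICM_S`»), p. 6 / §4 p. 9].

Conventions as in `CMOrderWeakClassesCount`.  Theorems only (no new definitions, no named facts).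

## References
* [Marseglia2019] S. Marseglia, *Computing the ideal class monoid of an order*, J. Lond. Math. Soc. 101 (2020),
  arXiv:1805.09671 — §2 p. 4; §3 Lemma 3.6 p. 6; §4 Def. 4.2 p. 8, («`ICM(R) = ⊔ ICM_S`») p. 9.
* [DadeTausskyZassenhaus1962] E. C. Dade, O. Taussky, H. Zassenhaus, *On the theory of orders …*, Math. Ann. 148 (1962), §1.
-/

noncomputable section

open scoped Classical nonZeroDivisors NumberField Pointwise
open NumberField Module FractionalIdeal

namespace Literature.NumberTheory.ComplexMultiplication

namespace CMTypeLattice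

section Restriction

variable {K : Type} [Field K] [NumberField K]
variable {ι : Type} [Fintype ι] [DecidableEq ι] (μ ν : Basis ι ℚ K)
variable [IsFractionRing (endOrder (Algebra.leftMulMatrix μ)) K] [IsFractionRing (endOrder (Algebra.leftMulMatrix ν)) K]

/-! ## §1 `(M:N)`, isomorphism and weak equivalence are read on lattices: `ICM_{S′}(𝔯) ≃ ICM_{S′}(S)` -/

omit [NumberField K] [Fintype ι] [DecidableEq ι] [IsFractionRing (endOrder (Algebra.leftMulMatrix μ)) K]
  [IsFractionRing (endOrder (Algebra.leftMulMatrix ν)) K] in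
/-- `x·I = x • I` as subsets of `K` (bookkeeping). [cite: Marseglia2019, §3 Cor. 3.4 («`I = αJ`»), p. 6] -/
private theorem coe_spanSingleton_mul_eq_smul'' {R : Type*} [CommRing R] {S : Submonoid R} [Algebra R K]
    [IsLocalization S K] (x : K) (I : FractionalIdeal S K) :
    ((spanSingleton S x * I : FractionalIdeal S K) : Set K) = x • (I : Set K) := by
  ext y
  rw [SetLike.mem_coe, mem_singleton_mul, Set.mem_smul_set]
  exact ⟨fun ⟨y', hy', h⟩ => ⟨y', hy', h.symm⟩, fun ⟨y', hy', h⟩ => ⟨y', hy', h.symm⟩⟩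

/-- **The ideal quotient `(M:N) = {x : xN ⊆ M}` is intrinsic to the lattices** (the same set whether `M`, `N` are read
as `𝔯`-ideals or as `S`-ideals). [cite: Marseglia2019, §2 («`(I:J) = {x ∈ K : xJ ⊆ I}`»), p. 4] -/
theorem coe_div_eq_coe_div_of_coe_eq {M N : FractionalIdeal (endOrder (Algebra.leftMulMatrix μ))⁰ K}
    {M' N' : FractionalIdeal (endOrder (Algebra.leftMulMatrix ν))⁰ K} (hN : N ≠ 0) (hN' : N' ≠ 0)
    (hM : (M : Set K) = M') (hNN : (N : Set K) = N') :
    ((M / N : FractionalIdeal (endOrder (Algebra.leftMulMatrix μ))⁰ K) : Set K) =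
      ((M' / N' : FractionalIdeal (endOrder (Algebra.leftMulMatrix ν))⁰ K) : Set K) := by
  have hmemM : ∀ y : K, y ∈ M ↔ y ∈ M' := fun y => by rw [← SetLike.mem_coe, hM, SetLike.mem_coe]
  have hmemN : ∀ y : K, y ∈ N ↔ y ∈ N' := fun y => by rw [← SetLike.mem_coe, hNN, SetLike.mem_coe]
  ext x
  rw [SetLike.mem_coe, SetLike.mem_coe, mem_div_iff_of_ne_zero hN, mem_div_iff_of_ne_zero hN']
  exact ⟨fun h y hy => (hmemM _).1 (h y ((hmemN y).2 hy)), fun h y hy => (hmemM _).2 (h y ((hmemN y).1 hy))⟩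

/-- **`ICM_{S′}(𝔯) ≃ ICM_{S′}(S)` for `𝔯 ⊆ S ⊆ S′`**: the classes modulo `K^×` of the `𝔯`-ideals with multiplicator
ring `S′` are the classes of the `S`-ideals with multiplicator ring `S′` (same lattices, same homotheties).
[cite: Marseglia2019, §2 («a fractional `R`-ideal `I` is also an `S`-ideal … if and only if `IS = I`») and §3 Lemma 3.6,
pp. 4, 6] -/
theorem nonempty_quot_stratum_equiv_quot_stratum_of_le
    (hle : endOrder (Algebra.leftMulMatrix μ) ≤ endOrder (Algebra.leftMulMatrix ν)) (S' : Subring K)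
    (hS' : endOrder (Algebra.leftMulMatrix ν) ≤ S') :
    Nonempty ((Quot fun M N : {M : FractionalIdeal (endOrder (Algebra.leftMulMatrix μ))⁰ K //
        M ≠ 0 ∧ ((M / M : FractionalIdeal (endOrder (Algebra.leftMulMatrix μ))⁰ K) : Set K) = S'} =>
      ∃ x : K, x ≠ 0 ∧ (M : FractionalIdeal (endOrder (Algebra.leftMulMatrix μ))⁰ K) =
        spanSingleton (endOrder (Algebra.leftMulMatrix μ))⁰ x * N) ≃
      Quot fun M N : {M : FractionalIdeal (endOrder (Algebra.leftMulMatrix ν))⁰ K //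
        M ≠ 0 ∧ ((M / M : FractionalIdeal (endOrder (Algebra.leftMulMatrix ν))⁰ K) : Set K) = S'} =>
      ∃ x : K, x ≠ 0 ∧ (M : FractionalIdeal (endOrder (Algebra.leftMulMatrix ν))⁰ K) =
        spanSingleton (endOrder (Algebra.leftMulMatrix ν))⁰ x * N) := by
  -- an `𝔯`-ideal with multiplicator ring `S′ ⊇ S` is `S`-stable
  have hst : ∀ M : {M : FractionalIdeal (endOrder (Algebra.leftMulMatrix μ))⁰ K //
      M ≠ 0 ∧ ((M / M : FractionalIdeal (endOrder (Algebra.leftMulMatrix μ))⁰ K) : Set K) = S'},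
      ∀ s ∈ endOrder (Algebra.leftMulMatrix ν), ∀ n ∈ (M : FractionalIdeal (endOrder (Algebra.leftMulMatrix μ))⁰ K),
        s * n ∈ (M : FractionalIdeal (endOrder (Algebra.leftMulMatrix μ))⁰ K) := fun M s hs => by
    have hs' : s ∈ (((M : FractionalIdeal (endOrder (Algebra.leftMulMatrix μ))⁰ K) / M :
        FractionalIdeal (endOrder (Algebra.leftMulMatrix μ))⁰ K) : Set K) := by
      rw [M.2.2]
      exact hS' hs
    exact (mem_div_iff_of_ne_zero M.2.1).1 hs'
  have hFex := fun M : {M : FractionalIdeal (endOrder (Algebra.leftMulMatrix μ))⁰ K //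
      M ≠ 0 ∧ ((M / M : FractionalIdeal (endOrder (Algebra.leftMulMatrix μ))⁰ K) : Set K) = S'} =>
    exists_overorderIdeal_coe_eq μ ν M.2.1 (hst M)
  let F : {M : FractionalIdeal (endOrder (Algebra.leftMulMatrix μ))⁰ K //
      M ≠ 0 ∧ ((M / M : FractionalIdeal (endOrder (Algebra.leftMulMatrix μ))⁰ K) : Set K) = S'} →
      {M : FractionalIdeal (endOrder (Algebra.leftMulMatrix ν))⁰ K //
        M ≠ 0 ∧ ((M / M : FractionalIdeal (endOrder (Algebra.leftMulMatrix ν))⁰ K) : Set K) = S'} := fun M =>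
    ⟨(hFex M).choose, (hFex M).choose_spec.1, by
      rw [← coe_div_eq_coe_div_of_coe_eq μ ν M.2.1 (hFex M).choose_spec.1 (hFex M).choose_spec.2.symm
        (hFex M).choose_spec.2.symm, M.2.2]⟩
  have hF : ∀ M, ((F M : FractionalIdeal (endOrder (Algebra.leftMulMatrix ν))⁰ K) : Set K) =
      (M : FractionalIdeal (endOrder (Algebra.leftMulMatrix μ))⁰ K) := fun M => (hFex M).choose_spec.2
  have hGex := fun M' : {M : FractionalIdeal (endOrder (Algebra.leftMulMatrix ν))⁰ K //
      M ≠ 0 ∧ ((M / M : FractionalIdeal (endOrder (Algebra.leftMulMatrix ν))⁰ K) : Set K) = S'} =>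
    exists_coe_eq_overorderIdeal μ ν hle M'.2.1
  let G : {M : FractionalIdeal (endOrder (Algebra.leftMulMatrix ν))⁰ K //
      M ≠ 0 ∧ ((M / M : FractionalIdeal (endOrder (Algebra.leftMulMatrix ν))⁰ K) : Set K) = S'} →
      {M : FractionalIdeal (endOrder (Algebra.leftMulMatrix μ))⁰ K //
        M ≠ 0 ∧ ((M / M : FractionalIdeal (endOrder (Algebra.leftMulMatrix μ))⁰ K) : Set K) = S'} := fun M' =>
    ⟨(hGex M').choose, (hGex M').choose_spec.1, by
      rw [coe_div_eq_coe_div_of_coe_eq μ ν (hGex M').choose_spec.1 M'.2.1 (hGex M').choose_spec.2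
        (hGex M').choose_spec.2, M'.2.2]⟩
  have hG : ∀ M', ((G M' : FractionalIdeal (endOrder (Algebra.leftMulMatrix μ))⁰ K) : Set K) =
      (M' : FractionalIdeal (endOrder (Algebra.leftMulMatrix ν))⁰ K) := fun M' => (hGex M').choose_spec.2
  refine ⟨⟨Quot.lift (fun M => Quot.mk _ (F M)) ?_, Quot.lift (fun M' => Quot.mk _ (G M')) ?_, ?_, ?_⟩⟩
  · rintro M N ⟨x, hx, h⟩
    refine Quot.sound ⟨x, hx, SetLike.coe_injective ?_⟩
    rw [hF, h, coe_spanSingleton_mul_eq_smul'', coe_spanSingleton_mul_eq_smul'', hF]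
  · rintro M' N' ⟨x, hx, h⟩
    refine Quot.sound ⟨x, hx, SetLike.coe_injective ?_⟩
    rw [hG, h, coe_spanSingleton_mul_eq_smul'', coe_spanSingleton_mul_eq_smul'', hG]
  · intro q
    induction q using Quot.ind with
    | mk M =>
      change Quot.mk _ (G (F M)) = Quot.mk _ M
      congr 1
      exact Subtype.ext (SetLike.coe_injective ((hG (F M)).trans (hF M)))
  · intro q
    induction q using Quot.ind with
    | mk M' =>
      change Quot.mk _ (F (G M')) = Quot.mk _ M'
      congr 1
      exact Subtype.ext (SetLike.coe_injective ((hF (G M')).trans (hG M')))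

/-- **`#ICM_{S′}(𝔯) = #ICM_{S′}(S)`** for `𝔯 ⊆ S ⊆ S′`. [cite: Marseglia2019, §3 Lemma 3.6, p. 6] -/
theorem natCard_quot_stratum_eq_of_le
    (hle : endOrder (Algebra.leftMulMatrix μ) ≤ endOrder (Algebra.leftMulMatrix ν)) (S' : Subring K)
    (hS' : endOrder (Algebra.leftMulMatrix ν) ≤ S') :
    Nat.card (Quot fun M N : {M : FractionalIdeal (endOrder (Algebra.leftMulMatrix μ))⁰ K //
        M ≠ 0 ∧ ((M / M : FractionalIdeal (endOrder (Algebra.leftMulMatrix μ))⁰ K) : Set K) = S'} =>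
      ∃ x : K, x ≠ 0 ∧ (M : FractionalIdeal (endOrder (Algebra.leftMulMatrix μ))⁰ K) =
        spanSingleton (endOrder (Algebra.leftMulMatrix μ))⁰ x * N) =
    Nat.card (Quot fun M N : {M : FractionalIdeal (endOrder (Algebra.leftMulMatrix ν))⁰ K //
        M ≠ 0 ∧ ((M / M : FractionalIdeal (endOrder (Algebra.leftMulMatrix ν))⁰ K) : Set K) = S'} =>
      ∃ x : K, x ≠ 0 ∧ (M : FractionalIdeal (endOrder (Algebra.leftMulMatrix ν))⁰ K) =
        spanSingleton (endOrder (Algebra.leftMulMatrix ν))⁰ x * N) :=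
  Nat.card_congr (nonempty_quot_stratum_equiv_quot_stratum_of_le μ ν hle S' hS').some

/-- **`W̄k_{S′}(𝔯) ≃ W̄k_{S′}(S)`, counted** — weak equivalence `1 ∈ (M:N)(N:M)` is read on lattices too.
[cite: Marseglia2019, §4 Prop. 4.1 (b) and Def. 4.2, p. 8] -/
theorem natCard_quot_stratum_weak_eq_of_le
    (hle : endOrder (Algebra.leftMulMatrix μ) ≤ endOrder (Algebra.leftMulMatrix ν)) (S' : Subring K)
    (hS' : endOrder (Algebra.leftMulMatrix ν) ≤ S') :
    Nat.card (Quot fun M N : {M : FractionalIdeal (endOrder (Algebra.leftMulMatrix μ))⁰ K //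
        M ≠ 0 ∧ ((M / M : FractionalIdeal (endOrder (Algebra.leftMulMatrix μ))⁰ K) : Set K) = S'} =>
      (1 : K) ∈ (M : FractionalIdeal (endOrder (Algebra.leftMulMatrix μ))⁰ K) / N * (N / M)) =
    Nat.card (Quot fun M N : {M : FractionalIdeal (endOrder (Algebra.leftMulMatrix ν))⁰ K //
        M ≠ 0 ∧ ((M / M : FractionalIdeal (endOrder (Algebra.leftMulMatrix ν))⁰ K) : Set K) = S'} =>
      (1 : K) ∈ (M : FractionalIdeal (endOrder (Algebra.leftMulMatrix ν))⁰ K) / N * (N / M)) := by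
  have hst : ∀ M : {M : FractionalIdeal (endOrder (Algebra.leftMulMatrix μ))⁰ K //
      M ≠ 0 ∧ ((M / M : FractionalIdeal (endOrder (Algebra.leftMulMatrix μ))⁰ K) : Set K) = S'},
      ∀ s ∈ endOrder (Algebra.leftMulMatrix ν), ∀ n ∈ (M : FractionalIdeal (endOrder (Algebra.leftMulMatrix μ))⁰ K),
        s * n ∈ (M : FractionalIdeal (endOrder (Algebra.leftMulMatrix μ))⁰ K) := fun M s hs => by
    have hs' : s ∈ (((M : FractionalIdeal (endOrder (Algebra.leftMulMatrix μ))⁰ K) / M :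
        FractionalIdeal (endOrder (Algebra.leftMulMatrix μ))⁰ K) : Set K) := by
      rw [M.2.2]
      exact hS' hs
    exact (mem_div_iff_of_ne_zero M.2.1).1 hs'
  have hFex := fun M : {M : FractionalIdeal (endOrder (Algebra.leftMulMatrix μ))⁰ K //
      M ≠ 0 ∧ ((M / M : FractionalIdeal (endOrder (Algebra.leftMulMatrix μ))⁰ K) : Set K) = S'} =>
    exists_overorderIdeal_coe_eq μ ν M.2.1 (hst M)
  let F : {M : FractionalIdeal (endOrder (Algebra.leftMulMatrix μ))⁰ K //
      M ≠ 0 ∧ ((M / M : FractionalIdeal (endOrder (Algebra.leftMulMatrix μ))⁰ K) : Set K) = S'} →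
      {M : FractionalIdeal (endOrder (Algebra.leftMulMatrix ν))⁰ K //
        M ≠ 0 ∧ ((M / M : FractionalIdeal (endOrder (Algebra.leftMulMatrix ν))⁰ K) : Set K) = S'} := fun M =>
    ⟨(hFex M).choose, (hFex M).choose_spec.1, by
      rw [← coe_div_eq_coe_div_of_coe_eq μ ν M.2.1 (hFex M).choose_spec.1 (hFex M).choose_spec.2.symm
        (hFex M).choose_spec.2.symm, M.2.2]⟩
  have hF : ∀ M, ((F M : FractionalIdeal (endOrder (Algebra.leftMulMatrix ν))⁰ K) : Set K) =
      (M : FractionalIdeal (endOrder (Algebra.leftMulMatrix μ))⁰ K) := fun M => (hFex M).choose_spec.2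
  have hGex := fun M' : {M : FractionalIdeal (endOrder (Algebra.leftMulMatrix ν))⁰ K //
      M ≠ 0 ∧ ((M / M : FractionalIdeal (endOrder (Algebra.leftMulMatrix ν))⁰ K) : Set K) = S'} =>
    exists_coe_eq_overorderIdeal μ ν hle M'.2.1
  let G : {M : FractionalIdeal (endOrder (Algebra.leftMulMatrix ν))⁰ K //
      M ≠ 0 ∧ ((M / M : FractionalIdeal (endOrder (Algebra.leftMulMatrix ν))⁰ K) : Set K) = S'} →
      {M : FractionalIdeal (endOrder (Algebra.leftMulMatrix μ))⁰ K //
        M ≠ 0 ∧ ((M / M : FractionalIdeal (endOrder (Algebra.leftMulMatrix μ))⁰ K) : Set K) = S'} := fun M' =>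
    ⟨(hGex M').choose, (hGex M').choose_spec.1, by
      rw [coe_div_eq_coe_div_of_coe_eq μ ν (hGex M').choose_spec.1 M'.2.1 (hGex M').choose_spec.2
        (hGex M').choose_spec.2, M'.2.2]⟩
  have hG : ∀ M', ((G M' : FractionalIdeal (endOrder (Algebra.leftMulMatrix μ))⁰ K) : Set K) =
      (M' : FractionalIdeal (endOrder (Algebra.leftMulMatrix ν))⁰ K) := fun M' => (hGex M').choose_spec.2
  -- weak equivalence is read on the lattices `(M:N)(N:M)`
  have hwk : ∀ (M N : FractionalIdeal (endOrder (Algebra.leftMulMatrix μ))⁰ K)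
      (M' N' : FractionalIdeal (endOrder (Algebra.leftMulMatrix ν))⁰ K), M ≠ 0 → N ≠ 0 → M' ≠ 0 → N' ≠ 0 →
      (M : Set K) = M' → (N : Set K) = N' →
      ((1 : K) ∈ M / N * (N / M) ↔ (1 : K) ∈ M' / N' * (N' / M')) := by
    intro M N M' N' hM hN hM' hN' hMM hNN
    rw [← SetLike.mem_coe, coe_mul_eq_coe_mul_of_coe_eq μ ν (coe_div_eq_coe_div_of_coe_eq μ ν hN hN' hMM hNN)
      (coe_div_eq_coe_div_of_coe_eq μ ν hM hM' hNN hMM), SetLike.mem_coe]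
  refine Nat.card_congr ⟨Quot.lift (fun M => Quot.mk _ (F M)) ?_, Quot.lift (fun M' => Quot.mk _ (G M')) ?_, ?_, ?_⟩
  · intro M N h
    exact Quot.sound ((hwk M.1 N.1 (F M).1 (F N).1 M.2.1 N.2.1 (F M).2.1 (F N).2.1 (hF M).symm (hF N).symm).1 h)
  · intro M' N' h
    exact Quot.sound ((hwk (G M').1 (G N').1 M'.1 N'.1 (G M').2.1 (G N').2.1 M'.2.1 N'.2.1 (hG M') (hG N')).2 h)
  · intro q
    induction q using Quot.ind with
    | mk M =>
      change Quot.mk _ (G (F M)) = Quot.mk _ M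
      congr 1
      exact Subtype.ext (SetLike.coe_injective ((hG (F M)).trans (hF M)))
  · intro q
    induction q using Quot.ind with
    | mk M' =>
      change Quot.mk _ (F (G M')) = Quot.mk _ M'
      congr 1
      exact Subtype.ext (SetLike.coe_injective ((hF (G M')).trans (hG M')))

/-! ## §2 `#ICM(𝔯) = #ICM(S) + Σ_{S′ ⊉ S} #ICM_{S′}(𝔯)` -/

/-- **`#ICM(S) = Σ_{S′ ⊇ S} #ICM_{S′}(𝔯)`** — the partition of `ICM(S)` by multiplicator rings, its strata read among
the `𝔯`-ideals. [cite: Marseglia2019, §3 Lemma 3.6 («`ICM(R) = ⊔ ICM_S`»), p. 6] -/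
theorem natCard_quot_fractionalIdeal_eq_sum_of_le
    (hle : endOrder (Algebra.leftMulMatrix μ) ≤ endOrder (Algebra.leftMulMatrix ν)) :
    Nat.card (Quot fun M N : {M : FractionalIdeal (endOrder (Algebra.leftMulMatrix ν))⁰ K // M ≠ 0} =>
      ∃ x : K, x ≠ 0 ∧ (M : FractionalIdeal (endOrder (Algebra.leftMulMatrix ν))⁰ K) =
        spanSingleton (endOrder (Algebra.leftMulMatrix ν))⁰ x * N) =
      ∑ S' ∈ (EndOrder.finite_setOf_overorder (ρ := Algebra.leftMulMatrix ν) (K := K)).toFinset,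
        Nat.card (Quot fun M N : {M : FractionalIdeal (endOrder (Algebra.leftMulMatrix μ))⁰ K //
            M ≠ 0 ∧ ((M / M : FractionalIdeal (endOrder (Algebra.leftMulMatrix μ))⁰ K) : Set K) = S'} =>
          ∃ x : K, x ≠ 0 ∧ (M : FractionalIdeal (endOrder (Algebra.leftMulMatrix μ))⁰ K) =
            spanSingleton (endOrder (Algebra.leftMulMatrix μ))⁰ x * N) := by
  classical
  haveI : Nonempty ι := μ.index_nonempty
  rw [EndOrder.natCard_quot_fractionalIdeal_eq_sum_natCard_quot_stratum]
  refine Finset.sum_congr rfl fun S' hS' => ?_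
  rw [Set.Finite.mem_toFinset] at hS'
  exact (natCard_quot_stratum_eq_of_le μ ν hle S' hS'.1).symm

/-- **`#ICM(𝔯) = #ICM(S) + Σ_{S′ ⊇ 𝔯, S′ ⊉ S} #ICM_{S′}(𝔯)`** for orders `𝔯 ⊆ S`: the classes with multiplicator
ring containing `S` are `ICM(S)`, the others are the strata of the over-orders of `𝔯` not containing `S`.
[cite: Marseglia2019, §3 Lemma 3.6 («`ICM(R) = ⊔ ICM_S`»), p. 6] -/
theorem natCard_quot_fractionalIdeal_eq_natCard_add_sum
    (hle : endOrder (Algebra.leftMulMatrix μ) ≤ endOrder (Algebra.leftMulMatrix ν)) :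
    Nat.card (Quot fun M N : {M : FractionalIdeal (endOrder (Algebra.leftMulMatrix μ))⁰ K // M ≠ 0} =>
      ∃ x : K, x ≠ 0 ∧ (M : FractionalIdeal (endOrder (Algebra.leftMulMatrix μ))⁰ K) =
        spanSingleton (endOrder (Algebra.leftMulMatrix μ))⁰ x * N) =
    Nat.card (Quot fun M N : {M : FractionalIdeal (endOrder (Algebra.leftMulMatrix ν))⁰ K // M ≠ 0} =>
      ∃ x : K, x ≠ 0 ∧ (M : FractionalIdeal (endOrder (Algebra.leftMulMatrix ν))⁰ K) =
        spanSingleton (endOrder (Algebra.leftMulMatrix ν))⁰ x * N) +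
      ∑ S' ∈ ((EndOrder.finite_setOf_overorder (ρ := Algebra.leftMulMatrix μ) (K := K)).toFinset.filter
          fun S' : Subring K => ¬ endOrder (Algebra.leftMulMatrix ν) ≤ S'),
        Nat.card (Quot fun M N : {M : FractionalIdeal (endOrder (Algebra.leftMulMatrix μ))⁰ K //
            M ≠ 0 ∧ ((M / M : FractionalIdeal (endOrder (Algebra.leftMulMatrix μ))⁰ K) : Set K) = S'} =>
          ∃ x : K, x ≠ 0 ∧ (M : FractionalIdeal (endOrder (Algebra.leftMulMatrix μ))⁰ K) =
            spanSingleton (endOrder (Algebra.leftMulMatrix μ))⁰ x * N) := by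
  classical
  haveI : Nonempty ι := μ.index_nonempty
  rw [EndOrder.natCard_quot_fractionalIdeal_eq_sum_natCard_quot_stratum (ρ := Algebra.leftMulMatrix μ),
    natCard_quot_fractionalIdeal_eq_sum_of_le μ ν hle,
    ← Finset.sum_filter_add_sum_filter_not _ fun S' : Subring K => endOrder (Algebra.leftMulMatrix ν) ≤ S']
  congr 1
  refine Finset.sum_congr (Finset.ext fun S' => ?_) fun _ _ => rfl
  rw [Finset.mem_filter, Set.Finite.mem_toFinset, Set.Finite.mem_toFinset]
  exact ⟨fun ⟨⟨_, hfin⟩, hS⟩ => ⟨hS, hfin⟩, fun ⟨hS, hfin⟩ => ⟨⟨hle.trans hS, hfin⟩, hS⟩⟩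

end Restriction

end CMTypeLattice

end Literature.NumberTheory.ComplexMultiplication
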